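import Mathlib
import HarnessLib
import HarnessLib.Audit
import Summits.Langlands.Statement
import Summits.Langlands.Langlands.Theses.RootDecomp1
import Summits.Langlands.Langlands.Theses.IwahoriBlockSplit
set_option linter.dupNamespace false
set_option linter.unusedVariables false
set_option linter.unusedSectionVars false

/-!
# Birth skeleton (BC3) for crux `IwahoriBlockSplit.NonIwahoriBlockMatching` — line `birth` (PRE-BIRTH form: the cell is a local def with the
route text VERBATIM; after birth replace it by the route decl `Summit.Langlands.Langlands.Theses.IwahoriBlockSplit.NonIwahoriBlockMatching`).
Node `IwahoriBlockSplit` (decomp-langlands lens-2 g22; child route refining `RootDecomp1:SemisimpleMatchingOneDatum` stmt-Langlands-23600).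
Shape: stubs `theorem stub_<name> : <signature> := by sorry` (each a genuine lemma of the line — no stub restates the cell, S or the summit:
probes `probes_stubs_NonIwahoriBlockMatching.lean`), `namespace _Goal` naming each stub statement, and the kernel-checked composition
`NonIwahoriBlockMatching_of … : <the crux>`.  `lean check --json`: rc 0, sorries = the stubs (5), none elsewhere.
-/

open scoped BigOperators Topology Manifold Classical MeasureTheory ProbabilityTheory Matrix InnerProductSpace ComplexConjugate ContinuousMap
open Filter Set Function TopologicalSpace MeasureTheory

namespace Summit.Langlands.Langlands.Cruxes.NonIwahoriBlockMatching.Birth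

/- POST-BIRTH (writer-1 g7): the cell is the route decl `Summit.Langlands.Langlands.Theses.IwahoriBlockSplit.NonIwahoriBlockMatching` (stmt-Langlands-28114) BY NAME; the pre-birth local `def NonIwahoriBlockMatching` (text VERBATIM = the route statement, sha12 8ac1528992bc) was removed; `stub_iwahoriBlock` now names the sibling cell `Summit.Langlands.Langlands.Theses.IwahoriBlockSplit.IwahoriBlockMatching` (stmt-Langlands-28113) BY NAME (pre-birth: its text VERBATIM). -/

/-- stub · `stub_toir` — TOIR `TraceOffInertiaRigidity` (node decl, pure linear algebra): two Weil–Deligne representations on the same space whose traces agree OFF inertia have equal traces everywhere — Cayley–Hamilton on Ψ = diag(S.ρ φ, S'.ρ φ) ∈ GL_{2n}(ℂ): a₀·tr B = −Σ_{k≥1} a_k tr(BΨ^k) with a₀ = ±det Ψ ≠ 0; Weil-group input = the PROVED facts IsFrobPow.mul_holds / unique_holds / exists_isFrobPow_holds; ATTACKABLE-NOW (instrument I-g22.1: land it as a Literature theorem). -/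
theorem stub_toir :
    ∀ (K : Type) [Field K] [NumberField K] (v : IsDedekindDomain.HeightOneSpectrum (NumberField.RingOfIntegers K)) (n : ℕ) (S S' : Literature.NumberTheory.GaloisRepresentations.WeilDeligneRep (v.adicCompletion K) ℂ (Fin n → ℂ)), (∀ w : Literature.NumberTheory.GaloisRepresentations.WeilGroup (v.adicCompletion K), w ∉ Literature.NumberTheory.GaloisRepresentations.WeilGroup.inertia (v.adicCompletion K) → LinearMap.trace ℂ (Fin n → ℂ) (S.ρ w) = LinearMap.trace ℂ (Fin n → ℂ) (S'.ρ w)) → ∀ w : Literature.NumberTheory.GaloisRepresentations.WeilGroup (v.adicCompletion K), LinearMap.trace ℂ (Fin n → ℂ) (S.ρ w) = LinearMap.trace ℂ (Fin n → ℂ) (S'.ρ w) := by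
  sorry

/-- stub · `stub_avatar` — E = host crux `RootDecomp1.SemisimpleAvatar` 23598 BY NAME (semisimple ℓ-adic avatars exist): the transport compares ρ with the avatar over solvable extensions. -/
theorem stub_avatar :
    Summit.Langlands.Langlands.Theses.RootDecomp1.SemisimpleAvatar := by
  sorry

/-- stub · `stub_irreducible` — Irr = host crux `RootDecomp1.CuspidalAvatarIrreducible` 23601 BY NAME (avatars of cuspidal π are irreducible): needed so that a.e.-compatibility pins ρ ≅ avatar (Chebotarev + Brauer–Nesbitt) and base changes stay in the cuspidal-or-isobaric regime the transport controls. -/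
theorem stub_irreducible :
    Summit.Langlands.Langlands.Theses.RootDecomp1.CuspidalAvatarIrreducible := by
  sorry

/-- stub · `stub_iwahoriBlock` — IW = the special cell `IwahoriBlockMatching` (text VERBATIM; after birth the route decl BY NAME) — used over the SOLVABLE-REACHABLE overfields L♮ of K at the places w' above v where the base-changed local component has become twisted-Iwahori. -/
theorem stub_iwahoriBlock :
    Summit.Langlands.Langlands.Theses.IwahoriBlockSplit.IwahoriBlockMatching := by
  sorry

/-- stub · `stub_transportCore` — the TRANSPORT CORE: TOIR → E → Irr → IW → NIW.  Memo §3: for a non-Iwahori place v and g ∈ W_{K_v} off inertia, pass to L = Fix(⟨g⟩·J) (J = joint kernel on inertia, open normal), E/L unramified cyclic making ḡ^m central, realise E = M_w̃ with M/K SOLVABLE Galois (chief series + Grunwald–Wang, split at the other bad places), descend π to the non-normal intermediate field L♮ = M^{⟨γ⟩} (NGBC¹: non-Galois cyclic-layer local base change compatibility at ONE inert unramified place — the single OPEN automorphic input; Galois-solvable layers = Arthur–Clozel III.4.2/5.1 + Henniart 2001), read tr at g from IW over L♮ (the base-changed component is twisted-Iwahori at w' by LLC-compatibility of base change), and recover the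 inertial traces by TOIR.  est. XL; PRINT∣{Galois-solvable-reachable g} + OPEN∣NGBC¹. -/
theorem stub_transportCore :
    (∀ (K : Type) [Field K] [NumberField K] (v : IsDedekindDomain.HeightOneSpectrum (NumberField.RingOfIntegers K)) (n : ℕ) (S S' : Literature.NumberTheory.GaloisRepresentations.WeilDeligneRep (v.adicCompletion K) ℂ (Fin n → ℂ)), (∀ w : Literature.NumberTheory.GaloisRepresentations.WeilGroup (v.adicCompletion K), w ∉ Literature.NumberTheory.GaloisRepresentations.WeilGroup.inertia (v.adicCompletion K) → LinearMap.trace ℂ (Fin n → ℂ) (S.ρ w) = LinearMap.trace ℂ (Fin n → ℂ) (S'.ρ w)) → ∀ w : Literature.NumberTheory.GaloisRepresentations.WeilGroup (v.adicCompletion K), LinearMap.trace ℂ (Fin n → ℂ) (S.ρ w) = LinearMap.trace ℂ (Fin n → ℂ) (S'.ρ w)) → Summit.Langlands.Langlands.Theses.RootDecomp1.SemisimpleAvatar → Summit.Langlands.Langlands.Theses.RootDecomp1.CuspidalAvatarIrreducible → (∀ (K : Type) [Field K] [NumberField K], Nonempty (ReciprocityData K) → ∃ Rec : ReciprocityData K,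 ∀ (n : ℕ) (hcpt : Literature.NumberTheory.Automorphic.isCompact_glFiniteIntegralLevel n K), 0 < n → ∀ (π : Literature.NumberTheory.Automorphic.CuspidalAutomorphicRepData n K hcpt), π.1.IsLAlgebraic → ∀ (ℓ : ℕ) [Fact ℓ.Prime] (ι : PadicAlgCl ℓ ≃+* ℂ) (ρ : Literature.NumberTheory.GaloisRepresentations.FramedGaloisRep K (PadicAlgCl ℓ) n), ρ.toGaloisRep.IsIrreducible → ((∀ᶠ v : IsDedekindDomain.HeightOneSpectrum (NumberField.RingOfIntegers K) in cofinite, ρ.IsUnramifiedAt v) ∧ ∀ (v : IsDedekindDomain.HeightOneSpectrum (NumberField.RingOfIntegers K)) (hv : ((ℓ : ℕ) : NumberField.RingOfIntegers K) ∈ v.asIdeal), (Literature.NumberTheory.PAdicHodge.fontainePstAdicCompletion v ℓ hv).IsDeRhamFramed (ρ.toLocal v)) → (∀ᶠ v : IsDedekindDomain.HeightOneSpectrum (NumberField.RingOfIntegers K) in cofinite, SatakeFrobCompatibleAt ι π.1 ρ v) → ∀ v : IsDedekindDomain.HeightOneSpectrum (NumberField.RingOfIntegers K), ((ℓ : ℕ)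 : NumberField.RingOfIntegers K) ∉ v.asIdeal → ¬ SatakeFrobCompatibleAt ι π.1 ρ v → (∃ (πv : Literature.NumberTheory.Automorphic.SmoothIrrep (Matrix.GeneralLinearGroup (Fin n) (v.adicCompletion K))), π.1.HasLocalComponentAt v πv.ρ ∧ ∃ χ : Matrix.GeneralLinearGroup (Fin n) (v.adicCompletion K) →* ℂˣ, IsOpen (χ.ker : Set (Matrix.GeneralLinearGroup (Fin n) (v.adicCompletion K))) ∧ ∃ w : πv.V, w ≠ 0 ∧ ∀ g ∈ Literature.NumberTheory.Automorphic.iwahoriGL n (v.adicCompletion K), (πv.ρ.twist χ) g w = w) → ∃ (πv : Literature.NumberTheory.Automorphic.SmoothIrrep (Matrix.GeneralLinearGroup (Fin n) (v.adicCompletion K))) (W : Literature.NumberTheory.GaloisRepresentations.WeilDeligneRep (v.adicCompletion K) (PadicAlgCl ℓ) (Fin n → (PadicAlgCl ℓ))) (Wℂ : Literature.NumberTheory.GaloisRepresentations.WeilDeligneRep (v.adicCompletion K) ℂ (Fin n → ℂ)) (S : Literature.NumberTheory.GaloisRepresentations.WeilDeligneRep (v.adicCompletion K) ℂ (Fin n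 → ℂ)) (hS : S.IsFrobSemisimple), π.1.HasLocalComponentAt v πv.ρ ∧ Literature.NumberTheory.GaloisRepresentations.IsWeilDeligneOfLadic (ρ.toLocal v).toWeilGroupHom W ∧ W.IsTransportAlong (ι : PadicAlgCl ℓ →+* ℂ) Wℂ ∧ Quotient.mk (Literature.NumberTheory.Automorphic.frobSemisimpleWDSetoid (v.adicCompletion K) n) ⟨S, hS⟩ = (Rec.llc v).recGL n (Literature.NumberTheory.Automorphic.IrrClass.mk πv) ∧ ∀ w : Literature.NumberTheory.GaloisRepresentations.WeilGroup (v.adicCompletion K), LinearMap.trace ℂ (Fin n → ℂ) (Wℂ.ρ w) = LinearMap.trace ℂ (Fin n → ℂ) (S.ρ w)) → (∀ (K : Type) [Field K] [NumberField K], Nonempty (ReciprocityData K) → ∃ Rec : ReciprocityData K, ∀ (n : ℕ) (hcpt : Literature.NumberTheory.Automorphic.isCompact_glFiniteIntegralLevel n K), 0 < n → ∀ (π : Literature.NumberTheory.Automorphic.CuspidalAutomorphicRepData n K hcpt), π.1.IsLAlgebraic → ∀ (ℓ : ℕ) [Fact ℓ.Prime] (ι : PadicAlgCl ℓ ≃+*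 ℂ) (ρ : Literature.NumberTheory.GaloisRepresentations.FramedGaloisRep K (PadicAlgCl ℓ) n), ρ.toGaloisRep.IsIrreducible → ((∀ᶠ v : IsDedekindDomain.HeightOneSpectrum (NumberField.RingOfIntegers K) in cofinite, ρ.IsUnramifiedAt v) ∧ ∀ (v : IsDedekindDomain.HeightOneSpectrum (NumberField.RingOfIntegers K)) (hv : ((ℓ : ℕ) : NumberField.RingOfIntegers K) ∈ v.asIdeal), (Literature.NumberTheory.PAdicHodge.fontainePstAdicCompletion v ℓ hv).IsDeRhamFramed (ρ.toLocal v)) → (∀ᶠ v : IsDedekindDomain.HeightOneSpectrum (NumberField.RingOfIntegers K) in cofinite, SatakeFrobCompatibleAt ι π.1 ρ v) → ∀ v : IsDedekindDomain.HeightOneSpectrum (NumberField.RingOfIntegers K), ((ℓ : ℕ) : NumberField.RingOfIntegers K) ∉ v.asIdeal → ¬ SatakeFrobCompatibleAt ι π.1 ρ v → ¬ (∃ (πv : Literature.NumberTheory.Automorphic.SmoothIrrep (Matrix.GeneralLinearGroup (Fin n) (v.adicCompletion K))), π.1.HasLocalComponentAt v πv.ρ ∧ ∃ χ : Matrix.GeneralLinearGroup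 (Fin n) (v.adicCompletion K) →* ℂˣ, IsOpen (χ.ker : Set (Matrix.GeneralLinearGroup (Fin n) (v.adicCompletion K))) ∧ ∃ w : πv.V, w ≠ 0 ∧ ∀ g ∈ Literature.NumberTheory.Automorphic.iwahoriGL n (v.adicCompletion K), (πv.ρ.twist χ) g w = w) → ∃ (πv : Literature.NumberTheory.Automorphic.SmoothIrrep (Matrix.GeneralLinearGroup (Fin n) (v.adicCompletion K))) (W : Literature.NumberTheory.GaloisRepresentations.WeilDeligneRep (v.adicCompletion K) (PadicAlgCl ℓ) (Fin n → (PadicAlgCl ℓ))) (Wℂ : Literature.NumberTheory.GaloisRepresentations.WeilDeligneRep (v.adicCompletion K) ℂ (Fin n → ℂ)) (S : Literature.NumberTheory.GaloisRepresentations.WeilDeligneRep (v.adicCompletion K) ℂ (Fin n → ℂ)) (hS : S.IsFrobSemisimple), π.1.HasLocalComponentAt v πv.ρ ∧ Literature.NumberTheory.GaloisRepresentations.IsWeilDeligneOfLadic (ρ.toLocal v).toWeilGroupHom W ∧ W.IsTransportAlong (ι : PadicAlgCl ℓ →+* ℂ) Wℂ ∧ Quotient.mk (Literature.NumberTheory.Automorphic.frobSemisimpleWDSetoid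 (v.adicCompletion K) n) ⟨S, hS⟩ = (Rec.llc v).recGL n (Literature.NumberTheory.Automorphic.IrrClass.mk πv) ∧ ∀ w : Literature.NumberTheory.GaloisRepresentations.WeilGroup (v.adicCompletion K), LinearMap.trace ℂ (Fin n → ℂ) (Wℂ.ρ w) = LinearMap.trace ℂ (Fin n → ℂ) (S.ρ w)) := by
  sorry

namespace _Goal

/-- statement of `stub_toir`. -/
def stub_toir : Prop :=
  ∀ (K : Type) [Field K] [NumberField K] (v : IsDedekindDomain.HeightOneSpectrum (NumberField.RingOfIntegers K)) (n : ℕ) (S S' : Literature.NumberTheory.GaloisRepresentations.WeilDeligneRep (v.adicCompletion K) ℂ (Fin n → ℂ)), (∀ w : Literature.NumberTheory.GaloisRepresentations.WeilGroup (v.adicCompletion K), w ∉ Literature.NumberTheory.GaloisRepresentations.WeilGroup.inertia (v.adicCompletion K) → LinearMap.trace ℂ (Fin n → ℂ) (S.ρ w) = LinearMap.trace ℂ (Fin n → ℂ) (S'.ρ w)) → ∀ w : Literature.NumberTheory.GaloisRepresentations.WeilGroup (v.adicCompletion K), LinearMap.trace ℂ (Fin n → ℂ) (S.ρ w) = LinearMap.trace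 ℂ (Fin n → ℂ) (S'.ρ w)

/-- statement of `stub_avatar`. -/
def stub_avatar : Prop :=
  Summit.Langlands.Langlands.Theses.RootDecomp1.SemisimpleAvatar

/-- statement of `stub_irreducible`. -/
def stub_irreducible : Prop :=
  Summit.Langlands.Langlands.Theses.RootDecomp1.CuspidalAvatarIrreducible

/-- statement of `stub_iwahoriBlock`. -/
def stub_iwahoriBlock : Prop :=
  Summit.Langlands.Langlands.Theses.IwahoriBlockSplit.IwahoriBlockMatching

/-- statement of `stub_transportCore`. -/
def stub_transportCore : Prop :=
  (∀ (K : Type) [Field K] [NumberField K] (v : IsDedekindDomain.HeightOneSpectrum (NumberField.RingOfIntegers K)) (n : ℕ) (S S' : Literature.NumberTheory.GaloisRepresentations.WeilDeligneRep (v.adicCompletion K) ℂ (Fin n → ℂ)), (∀ w : Literature.NumberTheory.GaloisRepresentations.WeilGroup (v.adicCompletion K), w ∉ Literature.NumberTheory.GaloisRepresentations.WeilGroup.inertia (v.adicCompletion K) → LinearMap.trace ℂ (Fin n → ℂ) (S.ρ w) = LinearMap.trace ℂ (Fin n → ℂ) (S'.ρ w)) → ∀ w : Literature.NumberTheory.GaloisRepresentations.WeilGroup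 (v.adicCompletion K), LinearMap.trace ℂ (Fin n → ℂ) (S.ρ w) = LinearMap.trace ℂ (Fin n → ℂ) (S'.ρ w)) → Summit.Langlands.Langlands.Theses.RootDecomp1.SemisimpleAvatar → Summit.Langlands.Langlands.Theses.RootDecomp1.CuspidalAvatarIrreducible → (∀ (K : Type) [Field K] [NumberField K], Nonempty (ReciprocityData K) → ∃ Rec : ReciprocityData K, ∀ (n : ℕ) (hcpt : Literature.NumberTheory.Automorphic.isCompact_glFiniteIntegralLevel n K), 0 < n → ∀ (π : Literature.NumberTheory.Automorphic.CuspidalAutomorphicRepData n K hcpt), π.1.IsLAlgebraic → ∀ (ℓ : ℕ) [Fact ℓ.Prime] (ι : PadicAlgCl ℓ ≃+* ℂ) (ρ : Literature.NumberTheory.GaloisRepresentations.FramedGaloisRep K (PadicAlgCl ℓ) n), ρ.toGaloisRep.IsIrreducible → ((∀ᶠ v : IsDedekindDomain.HeightOneSpectrum (NumberField.RingOfIntegers K) in cofinite, ρ.IsUnramifiedAt v) ∧ ∀ (v : IsDedekindDomain.HeightOneSpectrum (NumberField.RingOfIntegers K)) (hv : ((ℓ : ℕ) : NumberField.RingOfIntegers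 K) ∈ v.asIdeal), (Literature.NumberTheory.PAdicHodge.fontainePstAdicCompletion v ℓ hv).IsDeRhamFramed (ρ.toLocal v)) → (∀ᶠ v : IsDedekindDomain.HeightOneSpectrum (NumberField.RingOfIntegers K) in cofinite, SatakeFrobCompatibleAt ι π.1 ρ v) → ∀ v : IsDedekindDomain.HeightOneSpectrum (NumberField.RingOfIntegers K), ((ℓ : ℕ) : NumberField.RingOfIntegers K) ∉ v.asIdeal → ¬ SatakeFrobCompatibleAt ι π.1 ρ v → (∃ (πv : Literature.NumberTheory.Automorphic.SmoothIrrep (Matrix.GeneralLinearGroup (Fin n) (v.adicCompletion K))), π.1.HasLocalComponentAt v πv.ρ ∧ ∃ χ : Matrix.GeneralLinearGroup (Fin n) (v.adicCompletion K) →* ℂˣ, IsOpen (χ.ker : Set (Matrix.GeneralLinearGroup (Fin n) (v.adicCompletion K))) ∧ ∃ w : πv.V, w ≠ 0 ∧ ∀ g ∈ Literature.NumberTheory.Automorphic.iwahoriGL n (v.adicCompletion K), (πv.ρ.twist χ) g w = w) → ∃ (πv : Literature.NumberTheory.Automorphic.SmoothIrrep (Matrix.GeneralLinearGroup (Fin n)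 (v.adicCompletion K))) (W : Literature.NumberTheory.GaloisRepresentations.WeilDeligneRep (v.adicCompletion K) (PadicAlgCl ℓ) (Fin n → (PadicAlgCl ℓ))) (Wℂ : Literature.NumberTheory.GaloisRepresentations.WeilDeligneRep (v.adicCompletion K) ℂ (Fin n → ℂ)) (S : Literature.NumberTheory.GaloisRepresentations.WeilDeligneRep (v.adicCompletion K) ℂ (Fin n → ℂ)) (hS : S.IsFrobSemisimple), π.1.HasLocalComponentAt v πv.ρ ∧ Literature.NumberTheory.GaloisRepresentations.IsWeilDeligneOfLadic (ρ.toLocal v).toWeilGroupHom W ∧ W.IsTransportAlong (ι : PadicAlgCl ℓ →+* ℂ) Wℂ ∧ Quotient.mk (Literature.NumberTheory.Automorphic.frobSemisimpleWDSetoid (v.adicCompletion K) n) ⟨S, hS⟩ = (Rec.llc v).recGL n (Literature.NumberTheory.Automorphic.IrrClass.mk πv) ∧ ∀ w : Literature.NumberTheory.GaloisRepresentations.WeilGroup (v.adicCompletion K), LinearMap.trace ℂ (Fin n → ℂ) (Wℂ.ρ w) = LinearMap.trace ℂ (Fin n → ℂ) (S.ρ w)) → (∀ (K : Type) [Field K]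 [NumberField K], Nonempty (ReciprocityData K) → ∃ Rec : ReciprocityData K, ∀ (n : ℕ) (hcpt : Literature.NumberTheory.Automorphic.isCompact_glFiniteIntegralLevel n K), 0 < n → ∀ (π : Literature.NumberTheory.Automorphic.CuspidalAutomorphicRepData n K hcpt), π.1.IsLAlgebraic → ∀ (ℓ : ℕ) [Fact ℓ.Prime] (ι : PadicAlgCl ℓ ≃+* ℂ) (ρ : Literature.NumberTheory.GaloisRepresentations.FramedGaloisRep K (PadicAlgCl ℓ) n), ρ.toGaloisRep.IsIrreducible → ((∀ᶠ v : IsDedekindDomain.HeightOneSpectrum (NumberField.RingOfIntegers K) in cofinite, ρ.IsUnramifiedAt v) ∧ ∀ (v : IsDedekindDomain.HeightOneSpectrum (NumberField.RingOfIntegers K)) (hv : ((ℓ : ℕ) : NumberField.RingOfIntegers K) ∈ v.asIdeal), (Literature.NumberTheory.PAdicHodge.fontainePstAdicCompletion v ℓ hv).IsDeRhamFramed (ρ.toLocal v)) → (∀ᶠ v : IsDedekindDomain.HeightOneSpectrum (NumberField.RingOfIntegers K) in cofinite, SatakeFrobCompatibleAt ι π.1 ρ v) → ∀ v : IsDedekindDomain.HeightOneSpectrum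 (NumberField.RingOfIntegers K), ((ℓ : ℕ) : NumberField.RingOfIntegers K) ∉ v.asIdeal → ¬ SatakeFrobCompatibleAt ι π.1 ρ v → ¬ (∃ (πv : Literature.NumberTheory.Automorphic.SmoothIrrep (Matrix.GeneralLinearGroup (Fin n) (v.adicCompletion K))), π.1.HasLocalComponentAt v πv.ρ ∧ ∃ χ : Matrix.GeneralLinearGroup (Fin n) (v.adicCompletion K) →* ℂˣ, IsOpen (χ.ker : Set (Matrix.GeneralLinearGroup (Fin n) (v.adicCompletion K))) ∧ ∃ w : πv.V, w ≠ 0 ∧ ∀ g ∈ Literature.NumberTheory.Automorphic.iwahoriGL n (v.adicCompletion K), (πv.ρ.twist χ) g w = w) → ∃ (πv : Literature.NumberTheory.Automorphic.SmoothIrrep (Matrix.GeneralLinearGroup (Fin n) (v.adicCompletion K))) (W : Literature.NumberTheory.GaloisRepresentations.WeilDeligneRep (v.adicCompletion K) (PadicAlgCl ℓ) (Fin n → (PadicAlgCl ℓ))) (Wℂ : Literature.NumberTheory.GaloisRepresentations.WeilDeligneRep (v.adicCompletion K) ℂ (Fin n → ℂ)) (S : Literature.NumberTheory.GaloisRepresentations.WeilDeligneRep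 (v.adicCompletion K) ℂ (Fin n → ℂ)) (hS : S.IsFrobSemisimple), π.1.HasLocalComponentAt v πv.ρ ∧ Literature.NumberTheory.GaloisRepresentations.IsWeilDeligneOfLadic (ρ.toLocal v).toWeilGroupHom W ∧ W.IsTransportAlong (ι : PadicAlgCl ℓ →+* ℂ) Wℂ ∧ Quotient.mk (Literature.NumberTheory.Automorphic.frobSemisimpleWDSetoid (v.adicCompletion K) n) ⟨S, hS⟩ = (Rec.llc v).recGL n (Literature.NumberTheory.Automorphic.IrrClass.mk πv) ∧ ∀ w : Literature.NumberTheory.GaloisRepresentations.WeilGroup (v.adicCompletion K), LinearMap.trace ℂ (Fin n → ℂ) (Wℂ.ρ w) = LinearMap.trace ℂ (Fin n → ℂ) (S.ρ w))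

end _Goal

/-- COMPOSITION (kernel-checked, no sorry): the stubs give the crux. -/
theorem NonIwahoriBlockMatching_of (h₁ : _Goal.stub_toir) (h₂ : _Goal.stub_avatar) (h₃ : _Goal.stub_irreducible) (h₄ : _Goal.stub_iwahoriBlock) (h₅ : _Goal.stub_transportCore) : Summit.Langlands.Langlands.Theses.IwahoriBlockSplit.NonIwahoriBlockMatching := by
  exact h₅ h₁ h₂ h₃ h₄

end Summit.Langlands.Langlands.Cruxes.NonIwahoriBlockMatching.Birth
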